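import Literature.Topology.PlanarFoliations.ProngStar
import HarnessLib

/-!
# Star data: punctured planar foliations whose punctures are centres or prong stars

Topic: Topology / PlanarFoliations, sequel to `Punctures.lean`, `ProngStar.lean`, `Centres.lean`.
The setting of the graph case of the existence of vanishing cycles (Camacho–Lins Neto,
*Geometric Theory of Foliations*, Ch. VII §2; Tamura, *Topology of Foliations*, §25): a
`PunctureData` (a bi-oriented planar foliation induced by a foliated map `g ∘ ι` into `(M, T)`,
finitely many punctures) **each of whose punctures is a centre** (no point of its ball at its
level) **or carries a prong star** (`ProngStar`) inside its ball, whose common height `H` is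
**increasing with the level** of the puncture (the transverse coordinate of `g` in the flow box of
the puncture). For the contour foliation of a disc in checkerboard cone position these are the
cone centres and the four-prong stars at the vertices.

* `StarData` (**definition**);
* `StarData.levelH` (**definition**: the level as a function `Λ` of the common height of the star)
  and `StarData.level_eq_levelH`, `StarData.strictMonoOn_levelH`, `StarData.continuousOn_levelH`,
  `StarData.levelH_zero` (**proved**): on the sectors `level v = Λ_v ∘ H`, with `Λ_v` continuous and
  strictly increasing on `[-ρ, ρ]`;
* `StarData.mem_ball_of_mem_S`, `StarData.mapsTo_S` (**proved**): the sectors lie in the ball and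
  are mapped into the flow box of the puncture.

## References

* C. Camacho, A. Lins Neto, *Geometric Theory of Foliations*, Birkhäuser (1985), Ch. VII §2
  [CamachoLinsNeto1985].
* I. Tamura, *Topology of Foliations*, AMS (1992), §25 [Tamura1992].
-/

noncomputable section

open Set Filter Function Metric
open _root_.Topology
open Literature.Topology.FourManifolds Literature.Topology.FourManifolds.Foliation

namespace Literature.Topology.PlanarFoliations

variable {X : Type*} [TopologicalSpace X] {F : Foliation ℝ X} {ι : X → ℂ}
variable {B : Type*} [TopologicalSpace B] {M : Type*} [TopologicalSpace M] {T : Foliation B M} {g : ℂ → M}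

variable (F ι T g) in
/-- **Star data**: puncture data whose punctures are centres or carry prong stars compatible with
the levels. See the module docstring. [cite: CamachoLinsNeto1985, Ch. VII §2] -/
structure StarData extends PunctureData F ι T g where
  /-- The number of prongs at each point of the plane (`0` off the saddle punctures). -/
  nprong : ℂ → ℕ
  /-- The prong star at a saddle puncture. -/
  star : ∀ v, nprong v ≠ 0 → ProngStar F ι v (nprong v)
  /-- Saddle punctures are punctures. -/
  mem_P : ∀ v, nprong v ≠ 0 → v ∈ P
  /-- **The other punctures are centres**: no point of the ball is at the level of the puncture. -/
  centre : ∀ v ∈ P, nprong v = 0 → ∀ y, ι y ∈ ball v (rad v) → (box v (g (ι y))).2 ≠ (box v (g v)).2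
  /-- The sectors of the stars lie in the balls. -/
  S_subset_ball : ∀ v (h : nprong v ≠ 0) j, (star v h).S j ⊆ ball v (rad v)
  /-- **Level compatibility**: on the sectors, the level of the puncture increases with the common
  height of the star. -/
  level_lt_iff : ∀ v (h : nprong v ≠ 0) i j, ∀ z ∈ (star v h).S i, ∀ z' ∈ (star v h).S j,
    (box v (g z)).2 < (box v (g z')).2 ↔ (star v h).H z < (star v h).H z'

namespace StarData

variable (D : StarData F ι T g) {v : ℂ}

/-- The sectors lie in the ball of the puncture. [folklore] -/
theorem mem_ball_of_mem_S (h : D.nprong v ≠ 0) {j : ZMod (D.nprong v)} {z : ℂ} (hz : z ∈ (D.star v h).S j) :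
    z ∈ ball v (D.rad v) :=
  D.S_subset_ball v h j hz

/-- `g` maps the sectors into the flow box of the puncture. [folklore] -/
theorem mapsTo_S (h : D.nprong v ≠ 0) (j : ZMod (D.nprong v)) : MapsTo g ((D.star v h).S j) (D.box v).source :=
  fun _ hz ↦ D.mapsTo_ball v (D.mem_P v h) (D.mem_ball_of_mem_S h hz)

/-- On the sectors, **equal heights give equal levels**. [folklore] -/
theorem level_eq_of_H_eq (h : D.nprong v ≠ 0) {i j : ZMod (D.nprong v)} {z z' : ℂ} (hz : z ∈ (D.star v h).S i)
    (hz' : z' ∈ (D.star v h).S j) (hH : (D.star v h).H z = (D.star v h).H z') :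
    D.level v z = D.level v z' := by
  have h₁ := D.level_lt_iff v h i j z hz z' hz'
  have h₂ := D.level_lt_iff v h j i z' hz' z hz
  rw [hH] at h₁ h₂
  have a : ¬ D.level v z < D.level v z' := fun hlt ↦ lt_irrefl _ (h₁.1 hlt)
  have b : ¬ D.level v z' < D.level v z := fun hlt ↦ lt_irrefl _ (h₂.1 hlt)
  exact le_antisymm (not_lt.1 b) (not_lt.1 a)

/-- **The level as a function of the height**: `Λ_v h = level v (pt 0 (0, h))`. [folklore] -/
def levelH (h : D.nprong v ≠ 0) (s : ℝ) : ℝ := D.level v ((D.star v h).pt 0 (0, s))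

/-- **On the sectors, the level is `Λ_v` of the height.** [folklore] -/
theorem level_eq_levelH (h : D.nprong v ≠ 0) {j : ZMod (D.nprong v)} {z : ℂ} (hz : z ∈ (D.star v h).S j) :
    D.level v z = D.levelH h ((D.star v h).H z) := by
  have hr : ((0 : ℝ), (D.star v h).H z) ∈ (D.star v h).rect := by
    have := (D.star v h).chart_mem_rect hz
    rw [ProngStar.mem_rect_iff] at this ⊢
    exact ⟨⟨le_rfl, (D.star v h).ρ_pos.le⟩, this.2⟩
  exact D.level_eq_of_H_eq h hz ((D.star v h).pt_mem hr) (by rw [(D.star v h).H_pt hr])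

/-- `Λ_v 0 = level v v`. [folklore] -/
theorem levelH_zero (h : D.nprong v ≠ 0) : D.levelH h 0 = D.level v v := by
  have := D.level_eq_levelH h ((D.star v h).mem 0)
  rw [(D.star v h).H_v] at this
  exact this.symm

/-- **`Λ_v` is strictly increasing on `[-ρ, ρ]`.** [folklore] -/
theorem strictMonoOn_levelH (h : D.nprong v ≠ 0) : StrictMonoOn (D.levelH h) (Icc (-(D.star v h).ρ) (D.star v h).ρ) := by
  intro s hs s' hs' hlt
  have hr : ∀ {u : ℝ}, u ∈ Icc (-(D.star v h).ρ) (D.star v h).ρ → ((0 : ℝ), u) ∈ (D.star v h).rect := fun hu ↦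
    (ProngStar.mem_rect_iff _).2 ⟨⟨le_rfl, (D.star v h).ρ_pos.le⟩, hu⟩
  have h₁ := (D.level_lt_iff v h 0 0 _ ((D.star v h).pt_mem (hr hs)) _ ((D.star v h).pt_mem (hr hs'))).2
  rw [(D.star v h).H_pt (hr hs), (D.star v h).H_pt (hr hs')] at h₁
  exact h₁ hlt

/-- **`Λ_v` is continuous on `[-ρ, ρ]`.** [folklore] -/
theorem continuousOn_levelH (h : D.nprong v ≠ 0) : ContinuousOn (D.levelH h) (Icc (-(D.star v h).ρ) (D.star v h).ρ) := by
  have hr : ∀ u ∈ Icc (-(D.star v h).ρ) (D.star v h).ρ, ((0 : ℝ), u) ∈ (D.star v h).rect := fun u hu ↦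
    (ProngStar.mem_rect_iff _).2 ⟨⟨le_rfl, (D.star v h).ρ_pos.le⟩, hu⟩
  have hc : ContinuousOn (fun u : ℝ ↦ (D.star v h).pt 0 (0, u)) (Icc (-(D.star v h).ρ) (D.star v h).ρ) :=
    ((D.star v h).continuousOn_pt 0).comp (continuous_const.prodMk continuous_id).continuousOn hr
  refine (D.continuousOn_level (D.mem_P v h)).comp hc fun u hu ↦ ?_
  exact D.mem_ball_of_mem_S h ((D.star v h).pt_mem (hr u hu))

/-- The level at an axis point. [folklore] -/
theorem level_pt (h : D.nprong v ≠ 0) (j : ZMod (D.nprong v)) {p : ℝ × ℝ} (hp : p ∈ (D.star v h).rect) :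
    D.level v ((D.star v h).pt j p) = D.levelH h p.2 := by
  rw [D.level_eq_levelH h ((D.star v h).pt_mem hp), (D.star v h).H_pt hp]

/-- On the sectors, `level v z < level v z'` iff `Λ (H z) < Λ (H z')`; in particular the level of
the sector points determines their height. [folklore] -/
theorem H_eq_of_level_eq (h : D.nprong v ≠ 0) {i j : ZMod (D.nprong v)} {z z' : ℂ} (hz : z ∈ (D.star v h).S i)
    (hz' : z' ∈ (D.star v h).S j) (hl : D.level v z = D.level v z') : (D.star v h).H z = (D.star v h).H z' := by
  rcases lt_trichotomy ((D.star v h).H z) ((D.star v h).H z') with hlt | heq | hlt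
  · have := (D.level_lt_iff v h i j z hz z' hz').2 hlt
    exact absurd hl (ne_of_lt this)
  · exact heq
  · have := (D.level_lt_iff v h j i z' hz' z hz).2 hlt
    exact absurd hl.symm (ne_of_lt this)

end StarData

end Literature.Topology.PlanarFoliations
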